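import Literature.NumberTheory.EllipticCurves.RootNumberTableTwoRescaleProofs
import Mathlib.Tactic.LinearCombination
import HarnessLib

/-!
# `W.rootNumberTwo` and `W.rootNumberTwo'` do not depend on the Weierstrass equation — proofs

Proof file (no new definition, no new fact) for the `ℚ₂` root-number table of
`Literature.NumberTheory.EllipticCurves.RootNumberTableTwo` (Kellock–Dokchitser 2023, §5; rows
`(0, 5, 2)` corrected after Rizzo 2003, Table III, in the primed versions).  Notation 5.1 of the source
reads the table on "any Weierstrass equation" of the curve, while the tree attaches
`WeierstrassCurve.rootNumberTwo W := w2OfInvariants W.c₄ W.c₆ W.Δ` and the corrected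
`WeierstrassCurve.rootNumberTwo'` to an EQUATION `W` over `ℚ`.  This file proves that both are
functions of the curve, unconditionally and with no minimality hypothesis on the equation:

* §3 `WeierstrassCurve.rootNumberTwo_variableChange`, `WeierstrassCurve.rootNumberTwo'_variableChange`:
  `(C • W).rootNumberTwo⁽'⁾ = W.rootNumberTwo⁽'⁾` for every change of variables `C = (u, r, s, t)` over
  `ℚ` and every `W` with `Δ ≠ 0` (`…_of_isElliptic` for elliptic curves), because the invariants of
  `C • W` are `(u⁻⁴c₄, u⁻⁶c₆, u⁻¹²Δ)` (Mathlib's `WeierstrassCurve.variableChange_c₄`, `_c₆`, `_Δ`;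
  Silverman, AEC III.1, Table 3.1) and
* §2 `KellockDokchitser.w2OfInvariants_rescale`, `KellockDokchitser.w2OfInvariants'_rescale`:
  `w2OfInvariants⁽'⁾ (u⁴c₄) (u⁶c₆) (u¹²Δ) = w2OfInvariants⁽'⁾ c₄ c₆ Δ` for `u ∈ ℚˣ`, `Δ ≠ 0`: the reduced
  triple `(C_Δ, C_6, C_4)` does not move (`shift_add`, `map_add_map_sub` of the sibling file
  `…RootNumberTableTwoRescaleProofs`), the odd parts move by ONE odd unit of `ℤ/64`
  (`exists_oddRes_congr` there), and
* §1 `KellockDokchitser.w2Table_congr_of_oddUnit` (and `w2Table'_congr_of_oddUnit`): the 80-row printed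
  table `w2Table C_Δ C_6 C_4 c₄' c₆' Δ'` takes the same value at `(a', b', d')` and at `(a, b, d)` whenever
  `a' ≡ (1 + 16j)a`, `b' ≡ (1 + 24j)b`, `d' ≡ (1 + 48j)d (mod 64)` for one `j ∈ ℤ`, `a` odd unless
  `C_4 = ⊤` and `b` odd unless `C_6 = ⊤`.

How §1 is proved.  No relation between `c₄, c₆, Δ` (such as `1728Δ = c₄³ − c₆²`) is needed: every
atomic condition of the table reads the residues through a combination that is separately invariant
under the substitution — `c₄' mod 4, 8, 16`, `c₆' mod 4, 8`, `Δ' mod 4`; `c₄' ± 4c_{6,e} mod 16` and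
`c₄' + 4c₆' mod 16`; `c₄' + c₆'`, `2c₄' + c₆'`, `5c₄'`, `c₄'c₆' mod 8`, `c₄'c₆' mod 4`, `2c₆' + c₄' mod 8`;
`2c₆' + c₄' mod 16, 32` (here `a`, `b` odd is used: the substitution adds `16j(a + 3b)` with `a + 3b`
even); and, on the branch `c₆' ≡ 3 (mod 4)` of the row `(C_Δ, C_6, C_4) = (10, 6, 4)`, the condition
`c₄' − 2c₆' ≡ 3, 19 (mod 64)`, which is invariant when `c₄' ≡ 1 (mod 4)` (the substitution adds
`16j(a − 3b)` with `4 ∣ a − 3b`) and false on both sides when `c₄' ≡ 3 (mod 4)`.  With these eighteen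
congruences in hand, `simp only` identifies the two unfolded tables (in the four cases `C_4 = ⊤`,
`C_6 = ⊤`, `c₆' ≡ 3 (4)` with `c₄' ≡ 1` or `3 (4)`, `c₆' ≢ 3 (4)`).

Pattern.  The assembly §2–§3 follows the Summit-side proof that Rizzo's `ℚ₃` table value
`W.rootNumberThree` is an invariant of the curve
(`Summits/BirchSwinnertonDyer/BirchSwinnertonDyer/Theorems/CyclotomicUntwistRootNumberThreeInvariance.lean`,
`rootNumberThree_variableChange`); the `ℚ₂` table needs residues modulo `64` instead of `9` and the
row-by-row blindness argument of §1 instead of a three-residue case split.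

## References
* [KellockDokchitser2023] L. Cowland Kellock, V. Dokchitser, *Root numbers and parity phenomena*,
  Bull. London Math. Soc. 55 (2023) = arXiv:2303.07883 — Notation 5.1 and §5, Table of `w(E/ℚ₂)`
  (arXiv pp. 25–26).
* [Rizzo2003] O. G. Rizzo, *Average root numbers for a nonconstant family of elliptic curves*,
  Compositio Math. 136 (2003) 1–23 — §1.2 and Table III (`p = 2`).
* [SilvermanAEC2009] J. H. Silverman, *The Arithmetic of Elliptic Curves*, 2nd ed., GTM 106, Springer
  2009 — III.1, Table 3.1.
-/

namespace Literature.NumberTheory.EllipticCurves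

namespace KellockDokchitser


/-! ## §1 The table is invariant under an odd `2`-adic unit rescaling of the odd parts -/

section Table

variable {a a' b b' d d' j : ℤ}

/-- `a' ≡ (1+16j)a (mod 64)` ⟹ `a' ≡ a (mod 16)`. [folklore] -/
private theorem emod_sixteen_eq (ha : a' ≡ (1 + 16 * j) * a [ZMOD 64]) : a' % 16 = a % 16 := by
  have h := ha.of_dvd (by norm_num : (16 : ℤ) ∣ 64)
  unfold Int.ModEq at h
  rw [h, show (1 + 16 * j) * a = a + 16 * (j * a) by ring, Int.add_mul_emod_self_left]

/-- `a' ≡ (1+16j)a (mod 64)` ⟹ `a' ≡ a (mod 8)`. [folklore] -/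
private theorem emod_eight_eq (ha : a' ≡ (1 + 16 * j) * a [ZMOD 64]) : a' % 8 = a % 8 := by
  have h := emod_sixteen_eq ha
  omega

/-- `a' ≡ (1+16j)a (mod 64)` ⟹ `a' ≡ a (mod 4)`. [folklore] -/
private theorem emod_four_eq (ha : a' ≡ (1 + 16 * j) * a [ZMOD 64]) : a' % 4 = a % 4 := by
  have h := emod_sixteen_eq ha
  omega

/-- `b' ≡ (1+24j)b (mod 64)` ⟹ `b' ≡ b (mod 8)`. [folklore] -/
private theorem emod_eight_eq' (hb : b' ≡ (1 + 24 * j) * b [ZMOD 64]) : b' % 8 = b % 8 := by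
  have h := hb.of_dvd (by norm_num : (8 : ℤ) ∣ 64)
  unfold Int.ModEq at h
  rw [h, show (1 + 24 * j) * b = b + 8 * (3 * j * b) by ring, Int.add_mul_emod_self_left]

/-- `b' ≡ (1+24j)b (mod 64)` ⟹ `b' ≡ b (mod 4)`. [folklore] -/
private theorem emod_four_eq' (hb : b' ≡ (1 + 24 * j) * b [ZMOD 64]) : b' % 4 = b % 4 := by
  have h := emod_eight_eq' hb
  omega

/-- `d' ≡ (1+48j)d (mod 64)` ⟹ `d' ≡ d (mod 4)`. [folklore] -/
private theorem emod_four_eq'' (hd : d' ≡ (1 + 48 * j) * d [ZMOD 64]) : d' % 4 = d % 4 := by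
  have h := hd.of_dvd (by norm_num : (4 : ℤ) ∣ 64)
  unfold Int.ModEq at h
  rw [h, show (1 + 48 * j) * d = d + 4 * (12 * j * d) by ring, Int.add_mul_emod_self_left]

/-- `(a' + 4·c_{6,e}(b')) ≡ (a + 4·c_{6,e}(b)) (mod 16)`: `c_{6,e}(b') − c_{6,e}(b) = (b' − b)·2^k` with `8 ∣ b' − b`.
[cite: KellockDokchitser2023, Notation 5.1 (c_{6,e})] -/
private theorem add_four_mul_c6e_emod_sixteen_eq (C6 : WithTop ℤ) (e : ℕ)
    (ha : a' ≡ (1 + 16 * j) * a [ZMOD 64]) (hb : b' ≡ (1 + 24 * j) * b [ZMOD 64]) :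
    (a' + 4 * c6e C6 b' e) % 16 = (a + 4 * c6e C6 b e) % 16 := by
  have h16 := emod_sixteen_eq ha
  have h8 := emod_eight_eq' hb
  cases C6 with
  | top => simp only [c6e]; omega
  | coe n =>
    simp only [c6e]
    have hr : b' = b + 8 * ((b' - b) / 8) := by omega
    set r := (b' - b) / 8
    have hk : b' * 2 ^ (n - (e : ℤ)).toNat = b * 2 ^ (n - (e : ℤ)).toNat + 8 * (r * 2 ^ (n - (e : ℤ)).toNat) := by
      rw [hr]; ring
    rw [hk]
    omega

/-- `(a' − 4·c_{6,e}(b')) ≡ (a − 4·c_{6,e}(b)) (mod 16)`. [cite: KellockDokchitser2023, Notation 5.1 (c_{6,e})] -/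
private theorem sub_four_mul_c6e_emod_sixteen_eq (C6 : WithTop ℤ) (e : ℕ)
    (ha : a' ≡ (1 + 16 * j) * a [ZMOD 64]) (hb : b' ≡ (1 + 24 * j) * b [ZMOD 64]) :
    (a' - 4 * c6e C6 b' e) % 16 = (a - 4 * c6e C6 b e) % 16 := by
  have h16 := emod_sixteen_eq ha
  have h8 := emod_eight_eq' hb
  cases C6 with
  | top => simp only [c6e]; omega
  | coe n =>
    simp only [c6e]
    have hr : b' = b + 8 * ((b' - b) / 8) := by omega
    set r := (b' - b) / 8
    have hk : b' * 2 ^ (n - (e : ℤ)).toNat = b * 2 ^ (n - (e : ℤ)).toNat + 8 * (r * 2 ^ (n - (e : ℤ)).toNat) := by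
      rw [hr]; ring
    rw [hk]
    omega

/-- `(2b' + a') ≡ (2b + a) (mod 32)` for ODD `a, b`: the difference is `16j(a + 3b)` with `a + 3b` even. [folklore] -/
private theorem two_mul_add_emod_thirtytwo_eq (ha : a' ≡ (1 + 16 * j) * a [ZMOD 64])
    (hb : b' ≡ (1 + 24 * j) * b [ZMOD 64]) (ha2 : a % 2 = 1) (hb2 : b % 2 = 1) :
    (2 * b' + a') % 32 = (2 * b + a) % 32 := by
  have hs : a + 3 * b = 2 * ((a + 3 * b) / 2) := by omega
  set s := (a + 3 * b) / 2
  have h1 : 2 * b' + a' ≡ 2 * ((1 + 24 * j) * b) + (1 + 16 * j) * a [ZMOD 64] := (hb.mul_left 2).add ha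
  have h2 : 2 * ((1 + 24 * j) * b) + (1 + 16 * j) * a = (2 * b + a) + 32 * (j * s) := by
    linear_combination (16 * j) * hs
  rw [h2] at h1
  have h3 := h1.of_dvd (by norm_num : (32 : ℤ) ∣ 64)
  unfold Int.ModEq at h3
  rw [h3, Int.add_mul_emod_self_left]

/-- … hence also `(2b' + a') ≡ (2b + a) (mod 16)` for odd `a, b`. [folklore] -/
private theorem two_mul_add_emod_sixteen_eq (ha : a' ≡ (1 + 16 * j) * a [ZMOD 64])
    (hb : b' ≡ (1 + 24 * j) * b [ZMOD 64]) (ha2 : a % 2 = 1) (hb2 : b % 2 = 1) :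
    (2 * b' + a') % 16 = (2 * b + a) % 16 := by
  have := two_mul_add_emod_thirtytwo_eq ha hb ha2 hb2; omega

/-- `(2b' + a') ≡ (2b + a) (mod 8)` (no parity hypothesis needed). [folklore] -/
private theorem two_mul_add_emod_eight_eq (ha : a' ≡ (1 + 16 * j) * a [ZMOD 64])
    (hb : b' ≡ (1 + 24 * j) * b [ZMOD 64]) : (2 * b' + a') % 8 = (2 * b + a) % 8 := by
  have h1 := emod_eight_eq ha; have h2 := emod_eight_eq' hb; omega

/-- `a'b' ≡ ab (mod 8)` (`(1+16j)(1+24j) ≡ 1 (mod 8)`). [folklore] -/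
private theorem mul_emod_eight_eq (ha : a' ≡ (1 + 16 * j) * a [ZMOD 64]) (hb : b' ≡ (1 + 24 * j) * b [ZMOD 64]) :
    (a' * b') % 8 = (a * b) % 8 := by
  have h1 : a' * b' ≡ ((1 + 16 * j) * a) * ((1 + 24 * j) * b) [ZMOD 64] := ha.mul hb
  have h2 : ((1 + 16 * j) * a) * ((1 + 24 * j) * b) = a * b + 8 * ((5 * j + 48 * j ^ 2) * (a * b)) := by ring
  rw [h2] at h1
  have h3 := h1.of_dvd (by norm_num : (8 : ℤ) ∣ 64)
  unfold Int.ModEq at h3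
  rw [h3, Int.add_mul_emod_self_left]

/-- `a'b' ≡ ab (mod 4)`. [folklore] -/
private theorem mul_emod_four_eq (ha : a' ≡ (1 + 16 * j) * a [ZMOD 64]) (hb : b' ≡ (1 + 24 * j) * b [ZMOD 64]) :
    (a' * b') % 4 = (a * b) % 4 := by
  have := mul_emod_eight_eq ha hb; omega

/-- Row `(10, 6, 4)`: for `a ≡ 1`, `b ≡ 3 (mod 4)` the read `(a − 2b) mod 64` is invariant (the shift `16j(a − 3b)` has
`4 ∣ a − 3b`). [cite: KellockDokchitser2023, §5 Table, row (10,6,4)] -/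
private theorem sub_two_mul_emod_sixtyfour_eq (ha : a' ≡ (1 + 16 * j) * a [ZMOD 64])
    (hb : b' ≡ (1 + 24 * j) * b [ZMOD 64]) (ha4 : a % 4 = 1) (hb4 : b % 4 = 3) :
    (a' - 2 * b') % 64 = (a - 2 * b) % 64 := by
  have hs : a - 3 * b = 4 * ((a - 3 * b) / 4) := by omega
  set s := (a - 3 * b) / 4
  have h1 : a' - 2 * b' ≡ (1 + 16 * j) * a - 2 * ((1 + 24 * j) * b) [ZMOD 64] := ha.sub (hb.mul_left 2)
  have h2 : (1 + 16 * j) * a - 2 * ((1 + 24 * j) * b) = (a - 2 * b) + 64 * (j * s) := by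
    linear_combination (16 * j) * hs
  rw [h2] at h1
  unfold Int.ModEq at h1
  rw [h1, Int.add_mul_emod_self_left]

/-- **The table is invariant under an odd-unit rescaling of the odd parts** `(a, b, d) = (c₄', c₆', Δ') ↦ (a', b', d')` with
`a' ≡ (1+16j)a`, `b' ≡ (1+24j)b`, `d' ≡ (1+48j)d (mod 64)` (the residues of `w⁴a, w⁶b, w¹²d` for an odd `w` with
`w² ≡ 1 + 8j`), `a` odd unless `C_4 = ∞` and `b` odd unless `C_6 = ∞`: every condition of the 80 rows reads these residues
only through invariant combinations (`c₄'` mod 16, `c₆'` mod 8, `Δ'` mod 4, `2c₆' + c₄'` mod 32, `c₄'c₆'` mod 8, `c₄' ± 4c_{6,e}`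
mod 16, and `c₄' − 2c₆'` mod 64 on the branch `c₆' ≡ 3 (4)` of row `(10,6,4)`, where it is invariant for `c₄' ≡ 1 (4)` and false
on both sides for `c₄' ≡ 3 (4)`). [cite: KellockDokchitser2023, Notation 5.1 and §5 Table] -/
theorem w2Table_congr_of_oddUnit (CΔ : ℤ) (C6 C4 : WithTop ℤ)
    (ha : a' ≡ (1 + 16 * j) * a [ZMOD 64]) (hb : b' ≡ (1 + 24 * j) * b [ZMOD 64])
    (hd : d' ≡ (1 + 48 * j) * d [ZMOD 64]) (ha2 : C4 = ⊤ ∨ a % 2 = 1) (hb2 : C6 = ⊤ ∨ b % 2 = 1) :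
    w2Table CΔ C6 C4 a' b' d' = w2Table CΔ C6 C4 a b d := by
  have r1 := emod_four_eq ha
  have r2 := emod_eight_eq ha
  have r3 := emod_sixteen_eq ha
  have r4 := emod_four_eq' hb
  have r5 := emod_eight_eq' hb
  have r6 := emod_four_eq'' hd
  have r7 : (a' + 4 * b') % 16 = (a + 4 * b) % 16 := by omega
  have r8 := add_four_mul_c6e_emod_sixteen_eq C6 4 ha hb
  have r9 := sub_four_mul_c6e_emod_sixteen_eq C6 7 ha hb
  have r10 : (a' + b') % 8 = (a + b) % 8 := by omega
  have r11 := two_mul_add_emod_eight_eq ha hb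
  have r14 := mul_emod_eight_eq ha hb
  have r15 := mul_emod_four_eq ha hb
  have r16 : (5 * a') % 8 = (5 * a) % 8 := by omega
  have r18 : (2 * a' + b') % 8 = (2 * a + b) % 8 := by omega
  rcases ha2 with hC4 | ha2
  · -- `c₄ = 0`: every row reading `c₄'` has a finite `C_4`
    subst hC4
    unfold w2Table
    simp only [atLeast, r4, r5, r6, WithTop.top_ne_zero, WithTop.top_ne_ofNat, false_and, and_false, if_false,
      and_true]
  rcases hb2 with hC6 | hb2
  · -- `c₆ = 0`: every row reading `c₆'` beyond `c_{6,e} = 0` has a finite `C_6`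
    subst hC6
    unfold w2Table
    simp only [atLeast, c6e, r1, r2, r3, r6, WithTop.top_ne_zero, WithTop.top_ne_ofNat, false_and, and_false,
      if_false, true_and, mul_zero, add_zero, sub_zero]
  have r12 := two_mul_add_emod_sixteen_eq ha hb ha2 hb2
  have r13 := two_mul_add_emod_thirtytwo_eq ha hb ha2 hb2
  by_cases hb4 : b % 4 = 3
  · by_cases ha4 : a % 4 = 1
    · have r17 := sub_two_mul_emod_sixtyfour_eq ha hb ha4 hb4
      unfold w2Table
      simp only [r1, r2, r3, r4, r5, r6, r7, r8, r9, r10, r11, r12, r13, r14, r15, r16, r17, r18]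
    · have ha4' : a % 4 = 3 := by omega
      have n1 : ¬ (a' - 2 * b') % 64 = 3 := by omega
      have n2 : ¬ (a' - 2 * b') % 64 = 19 := by omega
      have n3 : ¬ (a - 2 * b) % 64 = 3 := by omega
      have n4 : ¬ (a - 2 * b) % 64 = 19 := by omega
      unfold w2Table
      simp only [r1, r2, r3, r4, r5, r6, r7, r8, r9, r10, r11, r12, r13, r14, r15, r16, r18, n1, n2, n3, n4]
  · unfold w2Table
    simp only [r1, r2, r3, r4, r5, r6, r7, r8, r9, r10, r11, r12, r13, r14, r15, r16, r18, hb4, false_and,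
      and_false, if_false]

/-- The same for the CORRECTED table `w2Table'`. [cite: KellockDokchitser2023, §5 Table, rows (0,5,2) corrected] -/
theorem w2Table'_congr_of_oddUnit (CΔ : ℤ) (C6 C4 : WithTop ℤ)
    (ha : a' ≡ (1 + 16 * j) * a [ZMOD 64]) (hb : b' ≡ (1 + 24 * j) * b [ZMOD 64])
    (hd : d' ≡ (1 + 48 * j) * d [ZMOD 64]) (ha2 : C4 = ⊤ ∨ a % 2 = 1) (hb2 : C6 = ⊤ ∨ b % 2 = 1) :
    w2Table' CΔ C6 C4 a' b' d' = w2Table' CΔ C6 C4 a b d := by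
  unfold w2Table'
  rw [emod_four_eq ha, w2Table_congr_of_oddUnit CΔ C6 C4 ha hb hd ha2 hb2]

end Table

/-! ## §2 `w2OfInvariants`, `w2OfInvariants'` under `(c₄, c₆, Δ) ↦ (u⁴c₄, u⁶c₆, u¹²Δ)` -/

section Rescale

/-- **`w2OfInvariants` does not see the Weierstrass equation**: for `u ∈ ℚˣ` and `Δ ≠ 0`,
`w2OfInvariants (u⁴c₄) (u⁶c₆) (u¹²Δ) = w2OfInvariants c₄ c₆ Δ`.  The valuations move by
`(4, 6, 12)·v₂(u)`, the shift `m` by `v₂(u)` (`shift_add`), so the reduced triple `(C_Δ, C_6, C_4)` is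
unchanged; the odd parts move by the odd unit `u'` and the printed table cannot tell
(`w2Table_congr_of_oddUnit`).  This is the formal content of Notation 5.1's "for ANY Weierstrass
equation of `E`": two equations over `ℚ` of the same curve have invariants related by such a `u`
(Silverman, AEC III.1, Table 3.1).
[cite: KellockDokchitser2023, Notation 5.1 and §5 Table] [cite: SilvermanAEC2009, III.1 Table 3.1] -/
theorem w2OfInvariants_rescale {u : ℚ} (hu : u ≠ 0) (c₄ c₆ : ℚ) {Δ : ℚ} (hΔ : Δ ≠ 0) :
    w2OfInvariants (u ^ 4 * c₄) (u ^ 6 * c₆) (u ^ 12 * Δ) = w2OfInvariants c₄ c₆ Δ := by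
  unfold w2OfInvariants
  dsimp only
  have hvΔ : padicValRat 2 (u ^ 12 * Δ) = padicValRat 2 Δ + 12 * padicValRat 2 u := by
    rw [padicValRat.mul (pow_ne_zero _ hu) hΔ, padicValRat.pow]
    push_cast
    ring
  rw [hvΔ, val2_pow_mul hu 6, val2_pow_mul hu 4]
  push_cast
  rw [shift_add, map_add_map_sub, map_add_map_sub,
    show padicValRat 2 Δ + 12 * padicValRat 2 u
        - 12 * (shift (padicValRat 2 Δ) (val2 c₆) (val2 c₄) + padicValRat 2 u)
      = padicValRat 2 Δ - 12 * shift (padicValRat 2 Δ) (val2 c₆) (val2 c₄) by ring]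
  obtain ⟨j, h4, h6, h12⟩ := exists_oddRes_congr hu c₄ c₆ Δ
  exact w2Table_congr_of_oddUnit _ _ _ h4 h6 h12 (map_val2_eq_top_or_oddRes_odd c₄ _)
    (map_val2_eq_top_or_oddRes_odd c₆ _)

/-- **The corrected table does not see the Weierstrass equation either**:
`w2OfInvariants' (u⁴c₄) (u⁶c₆) (u¹²Δ) = w2OfInvariants' c₄ c₆ Δ` for `u ∈ ℚˣ`, `Δ ≠ 0` (same proof,
`w2Table'_congr_of_oddUnit`; the corrected rows `(0, 5, 2)` read `c₄' mod 4` and `c₄' + 4c_{6,4} mod 16`,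
both invariant). [cite: KellockDokchitser2023, Notation 5.1 and §5 Table, rows (0,5,2) corrected]
[cite: Rizzo2003, §1.2 and Table III] -/
theorem w2OfInvariants'_rescale {u : ℚ} (hu : u ≠ 0) (c₄ c₆ : ℚ) {Δ : ℚ} (hΔ : Δ ≠ 0) :
    w2OfInvariants' (u ^ 4 * c₄) (u ^ 6 * c₆) (u ^ 12 * Δ) = w2OfInvariants' c₄ c₆ Δ := by
  unfold w2OfInvariants'
  dsimp only
  have hvΔ : padicValRat 2 (u ^ 12 * Δ) = padicValRat 2 Δ + 12 * padicValRat 2 u := by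
    rw [padicValRat.mul (pow_ne_zero _ hu) hΔ, padicValRat.pow]
    push_cast
    ring
  rw [hvΔ, val2_pow_mul hu 6, val2_pow_mul hu 4]
  push_cast
  rw [shift_add, map_add_map_sub, map_add_map_sub,
    show padicValRat 2 Δ + 12 * padicValRat 2 u
        - 12 * (shift (padicValRat 2 Δ) (val2 c₆) (val2 c₄) + padicValRat 2 u)
      = padicValRat 2 Δ - 12 * shift (padicValRat 2 Δ) (val2 c₆) (val2 c₄) by ring]
  obtain ⟨j, h4, h6, h12⟩ := exists_oddRes_congr hu c₄ c₆ Δ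
  exact w2Table'_congr_of_oddUnit _ _ _ h4 h6 h12 (map_val2_eq_top_or_oddRes_odd c₄ _)
    (map_val2_eq_top_or_oddRes_odd c₆ _)

end Rescale

end KellockDokchitser

end Literature.NumberTheory.EllipticCurves

/-! ## §3 Curves over `ℚ`: `W.rootNumberTwo`, `W.rootNumberTwo'` are invariants of the curve -/

noncomputable section

namespace WeierstrassCurve

open Literature.NumberTheory.EllipticCurves KellockDokchitser

variable (C : VariableChange ℚ) (W : WeierstrassCurve ℚ)

/-- **`W.rootNumberTwo` does not depend on the Weierstrass equation** (`Δ ≠ 0`): for every change of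
variables `C = (u, r, s, t)` over `ℚ`, `(C • W).rootNumberTwo = W.rootNumberTwo` — the invariants of
`C • W` are `(u⁻⁴c₄, u⁻⁶c₆, u⁻¹²Δ)` (Silverman, AEC III.1, Table 3.1) and `w2OfInvariants_rescale`.
So the Kellock–Dokchitser table value is a function of the `ℚ`-isomorphism class of the curve, as
Notation 5.1 ("any Weierstrass equation of `E/K`") presupposes.
[cite: KellockDokchitser2023, Notation 5.1 and §5 Table] [cite: SilvermanAEC2009, III.1 Table 3.1] -/
theorem rootNumberTwo_variableChange (hΔ : W.Δ ≠ 0) : (C • W).rootNumberTwo = W.rootNumberTwo := by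
  rw [rootNumberTwo_def, rootNumberTwo_def, variableChange_c₄, variableChange_c₆, variableChange_Δ,
    w2OfInvariants_rescale (Units.ne_zero _) _ _ hΔ]

/-- **`W.rootNumberTwo'` (corrected table) does not depend on the Weierstrass equation** (`Δ ≠ 0`):
`(C • W).rootNumberTwo' = W.rootNumberTwo'` for every change of variables `C` over `ℚ`
(`w2OfInvariants'_rescale`).  In particular the referee question "is `rootNumberTwo'` well defined on
curves, not only on equations?" has the answer yes, unconditionally and without any minimality
hypothesis on the equation.
[cite: KellockDokchitser2023, Notation 5.1 and §5 Table, rows (0,5,2) corrected]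
[cite: Rizzo2003, §1.2 and Table III] [cite: SilvermanAEC2009, III.1 Table 3.1] -/
theorem rootNumberTwo'_variableChange (hΔ : W.Δ ≠ 0) : (C • W).rootNumberTwo' = W.rootNumberTwo' := by
  rw [rootNumberTwo'_def, rootNumberTwo'_def, variableChange_c₄, variableChange_c₆, variableChange_Δ,
    w2OfInvariants'_rescale (Units.ne_zero _) _ _ hΔ]

/-- The elliptic-curve form of `rootNumberTwo_variableChange`. [cite: KellockDokchitser2023, Notation 5.1] -/
theorem rootNumberTwo_variableChange_of_isElliptic [W.IsElliptic] :
    (C • W).rootNumberTwo = W.rootNumberTwo :=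
  rootNumberTwo_variableChange C W W.isUnit_Δ.ne_zero

/-- The elliptic-curve form of `rootNumberTwo'_variableChange`.
[cite: KellockDokchitser2023, Notation 5.1 and §5 Table, rows (0,5,2) corrected] -/
theorem rootNumberTwo'_variableChange_of_isElliptic [W.IsElliptic] :
    (C • W).rootNumberTwo' = W.rootNumberTwo' :=
  rootNumberTwo'_variableChange C W W.isUnit_Δ.ne_zero

end WeierstrassCurve

end
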